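import Summits.HodgeConjecture.CorCM.OcticWeilOrbitPowersHodgeOfMarkman
import Mathlib.GroupTheory.GroupAction.MultipleTransitivity
import HarnessLib

/-!
# COR-CM — the Galois orbit of a simple CM fourfold of Weil type: the twelve EVEN permutations of the conjugate pairs are
# realised in `Aut(ℂ)` as soon as `Aut(ℂ/k)` is `2`-transitive on the embeddings over `τ` (a `2`-transitive subgroup of
# `S₄` contains `A₄`)

Cell `pub-hodgecm2` (COR-CM), seat b30 gen 20 (2026-08-22); count-neutral own lane OCTIC-WEIL-ORBIT.  Theorems only; no
definition, no named fact, no `sorry`.  This file discharges the Galois input `hgal` of the frame form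
`hodgeConjectureFor_biproduct_comp_of_frame₃_of_markman` (`CorCM/OcticWeilOrbitPowersHodgeOfMarkman.lean`) from the
`2`-TRANSITIVITY hypothesis `h2t` of gen 19's OCTIC-WEIL22 (`CorCM/OcticWeilFourfoldFrameTransfer.lean`), which for a SIMPLE
realisation is Dodson's theorem (tree, `OcticWeilFourfold.twoTransitive_of_isSimple`).

SETTING.  `F ⊇ i(k)` fields, `τ : k → ℂ`, a frame `e : Hom(F, ℂ) ≃ Fin 4 × Bool` with `(e s).2 = [s ∘ i = τ]` (`he_sign`):
`a ↦ e⁻¹(a, true)` enumerates the four embeddings of `F` over `τ` (the "conjugate pairs").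

* §1 `exists_perm_of_comp_tau_eq` — an automorphism `ρ` of `ℂ` fixing `τ` PERMUTES the pairs: `ρ ∘ e⁻¹(a, true) =
  e⁻¹(π_ρ a, true)` for a (unique) `π_ρ ∈ Sym(Fin 4)`.
* §2 **`alternatingGroup_le_realised`** — the realised permutations `{π | ∃ ρ, ∀ a, ρ ∘ e⁻¹(a,true) = e⁻¹(π a, true)}` form
  a SUBGROUP of `Sym(Fin 4)` (composition / inverse of automorphisms); under `h2t` (every ordered pair of distinct pairs is
  moved to `(0, 1)`) it is `2`-pretransitive, hence contains the alternating group (Mathlib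
  `IsMultiplyPretransitive.alternatingGroup_le`: a `(|α| − 2)`-pretransitive subgroup of `Sym(α)` contains `Alt(α)`).
* §3 **`hgal_of_h2t`** — each tabulated even permutation `permTab r` (`Census/OcticWeilOrbit`) is realised:
  `∃ ρ_r, ∀ a, ρ_r ∘ e⁻¹(a, true) = e⁻¹(permTab r a, true)`; and the frame form of the Hodge conjecture for the products of
  copies of `E, B₁, B₂, B₃` with `h2t` in place of `hgal` (`hodgeConjectureFor_biproduct_comp_of_frame₃_of_markman_h2t`).
HONEST FRAMING: the Hodge-conjecture statement stays conditional on the displayed Markman binder; `HC_CM` is not asserted.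
[cite: Dodson1984, §3.3.2 Theorem] [cite: Shimura1998, §18.2 Lemma (i)]

## References
* [Dodson1984] B. Dodson, *The structure of Galois groups of CM-fields*, Trans. AMS 283 (1984), §3.1.1, §3.3.2 Theorem
  (`Gal(Kᶜ/ℚ) ≅ ℤ₂ × A₄` or `ℤ₂ × S₄` for a degenerate primitive octic type).
* [Shimura1998] G. Shimura, *Abelian varieties with complex multiplication and modular functions*, §18.2 Lemma (i).
* [Markman2025SurveySecant] E. Markman, arXiv:2509.23403, Thm. 1.2.
-/

noncomputable section

open CategoryTheory CategoryTheory.Limits NumberField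

namespace Summit.HodgeConjecture.CorCM.OcticWeilOrbit

open Literature.AlgebraicGeometry Literature.AlgebraicGeometry.Motives Literature.AlgebraicGeometry.HodgeTheory
open Literature.AlgebraicGeometry.ComplexMultiplication (IsCMTypeRealisation)
open Literature.AlgebraicGeometry.Pohlmann1968
open Literature.AlgebraicTopology.SingularHomology
open Literature.NumberTheory.ComplexMultiplication
open Summit.HodgeConjecture.CorCM.Census.OcticWeilOrbit (permTab signTab)
open Summit.HodgeConjecture.CorCM.OcticCurveFourfold (comp_injective)

open scoped Classical

/-! ## §1 Automorphisms fixing `τ` permute the conjugate pairs -/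

section Realisers

variable {F k : Type} [Field F] [Field k] {e : (F →+* ℂ) ≃ Fin 4 × Bool} {τ : k →+* ℂ} {i : k →+* F}
  (he_sign : ∀ s : F →+* ℂ, (e s).2 = true ↔ s.comp i = τ)

include he_sign in
/-- **An automorphism of `ℂ` fixing `τ` permutes the four embeddings over `τ`**: `ρ ∘ e⁻¹(a, true) = e⁻¹(π a, true)` for a
permutation `π` of `Fin 4` (injective self-map of a finite set). [cite: Shimura1998, §18.2 Lemma (i)] -/
theorem exists_perm_of_comp_tau_eq (ρ : ℂ ≃+* ℂ) (hρ : (ρ : ℂ →+* ℂ).comp τ = τ) :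
    ∃ π : Equiv.Perm (Fin 4), ∀ a : Fin 4, (ρ : ℂ →+* ℂ).comp (e.symm (a, true)) = e.symm (π a, true) := by
  -- the image of `e⁻¹(a, true)` lies over `τ`, so it is `e⁻¹(f a, true)`
  have hover : ∀ a : Fin 4, (e ((ρ : ℂ →+* ℂ).comp (e.symm (a, true)))).2 = true := fun a => by
    rw [he_sign, RingHom.comp_assoc, (he_sign _).1 (by rw [Equiv.apply_symm_apply]), hρ]
  let f : Fin 4 → Fin 4 := fun a => (e ((ρ : ℂ →+* ℂ).comp (e.symm (a, true)))).1
  have hf : ∀ a : Fin 4, (ρ : ℂ →+* ℂ).comp (e.symm (a, true)) = e.symm (f a, true) := fun a => by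
    apply e.injective
    rw [Equiv.apply_symm_apply]
    exact Prod.ext rfl (hover a)
  have hfinj : Function.Injective f := fun a b hab => by
    have h : (ρ : ℂ →+* ℂ).comp (e.symm (a, true)) = (ρ : ℂ →+* ℂ).comp (e.symm (b, true)) := by
      rw [hf a, hf b, hab]
    have h' := e.symm.injective (comp_injective (K := F) ρ h)
    exact (Prod.mk.inj h').1
  exact ⟨Equiv.ofBijective f (Finite.injective_iff_bijective.1 hfinj), fun a => hf a⟩

/-! ## §2 The realised permutations form a `2`-transitive subgroup of `S₄`, hence contain `A₄` -/

include he_sign in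
/-- **The realised permutations contain the alternating group.**  If every ordered pair of distinct conjugate pairs is moved
to `(0, 1)` by some automorphism of `ℂ` (`h2t`), then EVERY even permutation `π` of the four pairs is realised:
`∃ ρ, ∀ a, ρ ∘ e⁻¹(a, true) = e⁻¹(π a, true)` (realised permutations form a `2`-pretransitive subgroup of `S₄`; such a
subgroup contains `A₄`). [cite: Dodson1984, §3.3.2 Theorem] -/
theorem alternatingGroup_le_realised
    (h2t : ∀ a b : Fin 4, a ≠ b → ∃ ρ : ℂ ≃+* ℂ,
      (ρ : ℂ →+* ℂ).comp (e.symm (a, true)) = e.symm (0, true) ∧ (ρ : ℂ →+* ℂ).comp (e.symm (b, true)) = e.symm (1, true))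
    {π : Equiv.Perm (Fin 4)} (hπ : π ∈ alternatingGroup (Fin 4)) :
    ∃ ρ : ℂ ≃+* ℂ, ∀ a : Fin 4, (ρ : ℂ →+* ℂ).comp (e.symm (a, true)) = e.symm (π a, true) := by
  -- the subgroup of realised permutations
  let H : Subgroup (Equiv.Perm (Fin 4)) :=
    { carrier := {π | ∃ ρ : ℂ ≃+* ℂ, ∀ a : Fin 4, (ρ : ℂ →+* ℂ).comp (e.symm (a, true)) = e.symm (π a, true)}
      mul_mem' := by
        rintro π₁ π₂ ⟨ρ₁, h₁⟩ ⟨ρ₂, h₂⟩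
        refine ⟨ρ₂.trans ρ₁, fun a => ?_⟩
        rw [RingEquiv.coe_ringHom_trans, RingHom.comp_assoc, h₂ a, h₁ (π₂ a), Equiv.Perm.mul_apply]
      one_mem' := ⟨RingEquiv.refl ℂ, fun a => by rw [RingEquiv.coe_ringHom_refl, RingHom.id_comp, Equiv.Perm.one_apply]⟩
      inv_mem' := by
        rintro π ⟨ρ, h⟩
        refine ⟨ρ.symm, fun a => ?_⟩
        have key := h (π⁻¹ a)
        rw [show π (π⁻¹ a) = a from (Equiv.apply_eq_iff_eq_symm_apply π).mpr rfl] at key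
        rw [← key, ← RingHom.comp_assoc]
        have : ((ρ.symm : ℂ ≃+* ℂ) : ℂ →+* ℂ).comp (ρ : ℂ →+* ℂ) = RingHom.id ℂ :=
          RingHom.ext fun z => ρ.symm_apply_apply z
        rw [this, RingHom.id_comp] }
  -- every realiser of `(a, b) ↦ (0, 1)` yields an element of `H`
  have hmem : ∀ a b : Fin 4, a ≠ b → ∃ g : ↥H, (g : Equiv.Perm (Fin 4)) a = 0 ∧ (g : Equiv.Perm (Fin 4)) b = 1 := by
    intro a b hab
    obtain ⟨ρ, hρa, hρb⟩ := h2t a b hab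
    have hρτ : (ρ : ℂ →+* ℂ).comp τ = τ := by
      have ha : (e.symm (a, true)).comp i = τ := (he_sign _).1 (by rw [Equiv.apply_symm_apply])
      have h0 : (e.symm ((0 : Fin 4), true)).comp i = τ := (he_sign _).1 (by rw [Equiv.apply_symm_apply])
      calc (ρ : ℂ →+* ℂ).comp τ = ((ρ : ℂ →+* ℂ).comp (e.symm (a, true))).comp i := by rw [RingHom.comp_assoc, ha]
        _ = τ := by rw [hρa, h0]
    obtain ⟨π₀, hπ₀⟩ := exists_perm_of_comp_tau_eq he_sign ρ hρτ
    refine ⟨⟨π₀, ρ, hπ₀⟩, ?_, ?_⟩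
    · have h := (hπ₀ a).symm.trans hρa
      exact (Prod.mk.inj (e.symm.injective h)).1
    · have h := (hπ₀ b).symm.trans hρb
      exact (Prod.mk.inj (e.symm.injective h)).1
  -- `H` is `2`-pretransitive on `Fin 4`
  have h2 : MulAction.IsMultiplyPretransitive (↥H) (Fin 4) 2 := by
    rw [MulAction.is_two_pretransitive_iff]
    intro a b c d hab hcd
    obtain ⟨g₁, hg₁a, hg₁b⟩ := hmem a b hab
    obtain ⟨g₂, hg₂c, hg₂d⟩ := hmem c d hcd
    refine ⟨g₂⁻¹ * g₁, ?_, ?_⟩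
    · change ((g₂⁻¹ * g₁ : ↥H) : Equiv.Perm (Fin 4)) a = c
      rw [Subgroup.coe_mul, Subgroup.coe_inv, Equiv.Perm.mul_apply, hg₁a]
      exact Equiv.Perm.inv_eq_iff_eq.2 hg₂c.symm
    · change ((g₂⁻¹ * g₁ : ↥H) : Equiv.Perm (Fin 4)) b = d
      rw [Subgroup.coe_mul, Subgroup.coe_inv, Equiv.Perm.mul_apply, hg₁b]
      exact Equiv.Perm.inv_eq_iff_eq.2 hg₂d.symm
  have hcard : Nat.card (Fin 4) - 2 = 2 := by rw [Nat.card_eq_fintype_card, Fintype.card_fin]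
  have hle : alternatingGroup (Fin 4) ≤ H :=
    IsMultiplyPretransitive.alternatingGroup_le (Fin 4) H (by rw [hcard]; exact h2)
  exact hle hπ

/-! ## §3 The twelve tabulated even permutations are realised; the frame form under `2`-transitivity -/

/-- The table `permTab` of `Census/OcticWeilOrbit` lists EVEN permutations (each is a permutation of `Fin 4` of sign `1`).
[folklore] -/
theorem exists_even_perm_eq_permTab : ∀ r : Fin 12, ∃ π : Equiv.Perm (Fin 4),
    Equiv.Perm.sign π = 1 ∧ ∀ a : Fin 4, π a = permTab r a := by
  unfold permTab
  decide +kernel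

include he_sign in
/-- **`hgal` from `h2t`**: under `2`-transitivity of `Aut(ℂ/k)` on the embeddings over `τ` (frame form), each of the twelve
even permutations `permTab r` of the conjugate pairs is induced by an automorphism of `ℂ`. [cite: Dodson1984, §3.3.2 Theorem] -/
theorem hgal_of_h2t
    (h2t : ∀ a b : Fin 4, a ≠ b → ∃ ρ : ℂ ≃+* ℂ,
      (ρ : ℂ →+* ℂ).comp (e.symm (a, true)) = e.symm (0, true) ∧ (ρ : ℂ →+* ℂ).comp (e.symm (b, true)) = e.symm (1, true))
    (r : Fin 12) :
    ∃ ρ : ℂ ≃+* ℂ, ∀ a : Fin 4, (ρ : ℂ →+* ℂ).comp (e.symm (a, true)) = e.symm (permTab r a, true) := by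
  obtain ⟨π, hsign, hπ⟩ := exists_even_perm_eq_permTab r
  obtain ⟨ρ, hρ⟩ := alternatingGroup_le_realised he_sign h2t (Equiv.Perm.mem_alternatingGroup.2 hsign)
  exact ⟨ρ, fun a => by rw [hρ a, hπ a]⟩

end Realisers

/-! ### The frame form of the Hodge conjecture under `2`-transitivity -/

section Frame

variable {I : Type} {Kf : I → Type} [∀ i, Field (Kf i)] [∀ i, NumberField (Kf i)] [∀ i, IsCMField (Kf i)]
  {i₀ i₁ : I} {N : ℕ} {τ : Kf i₀ →+* ℂ}
  {A₄ : Fin 4 → AbelianVariety ℂ} {Φ₄ : ∀ j : Fin 4, CMType (Kf (orbitSlots i₀ i₁ j))}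
  {ι₄ : ∀ j, 𝓞 (Kf (orbitSlots i₀ i₁ j)) →+* End (A₄ j)}
  {θ₄ : ∀ j, Kf (orbitSlots i₀ i₁ j) →+* Module.End ℂ (complexBetti (A₄ j).X 1)}

/-- **The Hodge conjecture for every product of copies of `E, B₁, B₂, B₃` (frame form), GIVEN ONLY Markman's fourfold
theorem, under `2`-TRANSITIVITY** of `Aut(ℂ/k)` on the four embeddings of `F` over `τ` (`h2t`, exactly the Galois hypothesis
of gen 19's OCTIC-WEIL22; Dodson: automatic when one `B_m` is simple) in place of the `A₄`-realisation `hgal`.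
[cite: Markman2025SurveySecant, Thm. 1.2] [cite: Dodson1984, §3.3.2 Theorem] [cite: Pohlmann1968, Thm 1] -/
theorem hodgeConjectureFor_biproduct_comp_of_frame₃_of_markman_h2t
    (hW4 : Markman2025_weilClasses_algebraic_abelianFourfold) (κ : Fin N → Fin 4)
    (h8 : Module.finrank ℚ (Kf i₁) = 8) (h2 : Module.finrank ℚ (Kf i₀) = 2) (i : Kf i₀ →+* Kf i₁)
    (hA : ∀ j, IsCMTypeRealisation (Φ₄ j) (A₄ j) (ι₄ j) (θ₄ j))
    (e : (Kf i₁ →+* ℂ) ≃ Fin 4 × Bool)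
    (he_sign : ∀ s : Kf i₁ →+* ℂ, (e s).2 = true ↔ s.comp i = τ)
    (he_conj : ∀ s : Kf i₁ →+* ℂ, e (ComplexEmbedding.conjugate s) = ((e s).1, !(e s).2))
    (hΦ : ∀ (m : Fin 3) (s : Kf i₁ →+* ℂ), s ∈ (Φ₄ m.succ).1 ↔ (e s).2 = signTab 0 m (e s).1)
    (hΨ : ∀ σ : Kf i₀ →+* ℂ, σ ∈ (Φ₄ 0).1 ↔ σ = τ)
    (h2t : ∀ a b : Fin 4, a ≠ b → ∃ ρ : ℂ ≃+* ℂ,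
      (ρ : ℂ →+* ℂ).comp (e.symm (a, true)) = e.symm (0, true) ∧ (ρ : ℂ →+* ℂ).comp (e.symm (b, true)) = e.symm (1, true)) :
    HodgeConjectureFor (⨁ fun j => A₄ (κ j)).dim (⨁ fun j => A₄ (κ j)).X :=
  hodgeConjectureFor_biproduct_comp_of_frame₃_of_markman hW4 κ h8 h2 i hA e he_sign he_conj hΦ hΨ (hgal_of_h2t he_sign h2t)

end Frame

end Summit.HodgeConjecture.CorCM.OcticWeilOrbit

end
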